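import Summits.RiemannHypothesis.RiemannHypothesis.Theorems.OddSectorOddOneSignedWindowsImpliesRH
import Summits.RiemannHypothesis.RiemannHypothesis.Theorems.OddSectorOddOneSignedWindowsExistence
import Literature.NumberTheory.LFunctions.WeilOddGroundState
import Literature.NumberTheory.LFunctions.WeilOddThetaVector
import Literature.NumberTheory.LFunctions.WeilExplicitFormulaProofs
import HarnessLib

/-!
# Sketch — crux-ideate round 2, ideator 4: `deleaked-theta-christoffel`
# (crux `OddSector.OddOneSignedWindows`, stmt-RiemannHypothesis-17778)

Typed first lemma and transfer statements of the idea card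
`Ideas/deleaked-theta-christoffel.md`. No `sorry`; open statements are `def … : Prop`.

* §1  the D-cyclic ODD THETA CLUSTER `span{Φ^{(2j+1)} : j < J}` (`Φ = weilThetaPhi`; every member
  is an odd global null vector of Weil's form, `(Φ′)^(s) = −(s−½)ξ(s)`), the L²-LEAKAGE PENCIL of
  a window `a`, and its bottom vector (the DE-LEAKED odd theta vector);
* §2  FIRST LEMMA (RH-free, falsifiable, kit j026031): Christoffel–Darboux confinement — the
  de-leaked vector is one-signed on `(0,a)`, all its positive zeros lie in the tail `(a, ∞)`;
* §3  the transfer: `NonIntruderImpliesGood` (NII′) with `RH ∧ NII′ → OddOneSignedWindows`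
  (kernel-checked below) — NII′ does not imply RH (it is vacuously true in the ¬RH world beyond the
  onset of negativity), it is the crux's beyond-summit conjunct made window-wise and provable.
-/

noncomputable section

set_option linter.dupNamespace false

open MeasureTheory Set Filter
open scoped Topology BigOperators

namespace Summit.RiemannHypothesis.RiemannHypothesis.Cruxes.OddOneSignedWindows.DeleakedTheta

open Literature.NumberTheory.LFunctions
open Summit.RiemannHypothesis.RiemannHypothesis.Theses.OddSector
open Summit.RiemannHypothesis.RiemannHypothesis.Theorems.OddSector

/-! ## 1. The odd theta cluster and the L²-leakage pencil -/

/-- A member of the D-cyclic odd theta cluster: `c_v = Σ_{j<J} v_j · Φ^{(2j+1)}`, `Φ = weilThetaPhi`.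
Each `Φ^{(2j+1)}` is odd, Schwartz, and a global null vector of Weil's form. -/
def thetaOddCluster {J : ℕ} (v : Fin J → ℝ) (t : ℝ) : ℝ :=
  ∑ j : Fin J, v j * iteratedDeriv (2 * (j : ℕ) + 1) weilThetaPhi t

/-- Mass inside the window `(-a, a)`. -/
def massIn (a : ℝ) (c : ℝ → ℝ) : ℝ := ∫ t in Ioo (-a) a, c t ^ 2

/-- L²-leakage: mass outside the window. (Model of the true leakage `Re Q(c·𝟙_{[-a,a]}) =
Re Q(c·𝟙_{|t|>a})`, which for these super-exponentially narrow two-edge tails is the narrow-support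
log-coercive energy `≈ (2a + O(1))·leakL2`; see the card.) -/
def leakL2 (a : ℝ) (c : ℝ → ℝ) : ℝ := ∫ t in {t : ℝ | a < |t|}, c t ^ 2

/-- `v` is an L²-DE-LEAKED coefficient vector at window `a`: unit mass inside, minimal leakage among
unit-mass cluster members of the same dimension `J`. Its cluster member is the de-leaked odd theta
vector `c_{a,J}` (bottom vector of the leakage pencil). -/
def IsDeleakedL2 (a : ℝ) {J : ℕ} (v : Fin J → ℝ) : Prop :=
  massIn a (thetaOddCluster v) = 1 ∧
    ∀ w : Fin J → ℝ, massIn a (thetaOddCluster w) = 1 →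
      leakL2 a (thetaOddCluster v) ≤ leakL2 a (thetaOddCluster w)

/-! ## 2. FIRST LEMMA — Christoffel–Darboux confinement (RH-free) -/

/-- **First lemma of the line (RH-free, falsifiable; numerically TRUE at a ∈ {0.6, 0.7, …}, J ≤ 8,
kit j026031: 0 sign changes on (0,a), all J−1 zeros in (a, a+1.2)).** For every window `a ≥ 1/2`
and every dimension `J`, an L²-de-leaked odd theta vector is ONE-SIGNED on the right half-window.
Mechanism: in the one-theta-term zone `c_v = x^{5/4} R_v(x) e^{−πx}`, `x = e^{2t}`, with `R_v` a
real polynomial; the extremal `R` of a concentration problem "minimise ∫_{x>X} R²w / ∫_{x<X} R²w"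
is quasi-orthogonal for the tail weight, so its zeros lie in the TAIL `x > X = e^{2a}`
(Christoffel–Darboux / Gauss–Radau zero confinement). -/
def CDConfinementL2 : Prop :=
  ∀ a : ℝ, 1 / 2 ≤ a → ∀ J : ℕ, ∀ v : Fin J → ℝ, IsDeleakedL2 a v →
    (∀ t ∈ Ioo 0 a, 0 ≤ thetaOddCluster v t) ∨ (∀ t ∈ Ioo 0 a, thetaOddCluster v t ≤ 0)

/-- **Zero-location form**: every positive zero of a de-leaked odd theta vector lies in the tail
beyond the window edge. -/
def CDZerosInTail : Prop :=
  ∀ a : ℝ, 1 / 2 ≤ a → ∀ J : ℕ, ∀ v : Fin J → ℝ, IsDeleakedL2 a v →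
    ∀ t : ℝ, 0 < t → thetaOddCluster v t = 0 → a < t

/-! ## 3. The transfer: non-intruder windows are good -/

/-- A GOOD WINDOW (as in `Disproof.lean`): one carrying a one-signed real odd-sector ground state. -/
def GoodWindow (a : ℝ) : Prop :=
  ∃ u : ℝ → ℂ, IsWeilOddGroundState a u ∧ ∀ᵐ t : ℝ, t ∈ Ioo 0 a → (u t).im = 0 ∧ 0 ≤ (u t).re

/-- **NII′ — non-intruders are theta-shaped, i.o.**: beyond every height there is a window at
which "the odd ground energy is non-negative" implies "the window is good". STATUS: does NOT imply
RH (if RH fails, `ε_od(a) < 0` for all large `a` by Yoshida, and NII′ holds vacuously there); with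
RH it is exactly the crux (`oddOneSignedWindows_of_rh`). It is the beyond-summit conjunct of the
crux made window-wise; the card's line PROVES it from `CDConfinementL2`-type shape theorems, the
landed `OriginLayerLemma`, and a conditional (on `0 ≤ ε_od(a)`) relative cluster-dominance
statement at non-resonant windows. -/
def NonIntruderImpliesGood : Prop :=
  ∀ A : ℝ, ∃ a : ℝ, A ≤ a ∧ (0 ≤ weilOddGroundEnergy a → GoodWindow a)

/-- RH gives non-negative odd ground energies at every window (easy half of Weil's criterion,
`WeilPositivity.of_riemannHypothesis` + `explicit_formula_holds`, and the `sInf`). -/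
theorem weilOddGroundEnergy_nonneg_of_rh (hRH : _root_.RiemannHypothesis) (a : ℝ) :
    0 ≤ weilOddGroundEnergy a := by
  rcases le_or_gt a 0 with ha | ha
  · rw [weilOddGroundEnergy_of_nonpos ha]
  · have hW : WeilPositivity := WeilPositivity.of_riemannHypothesis explicit_formula_holds hRH
    unfold weilOddGroundEnergy
    apply le_csInf
    · obtain ⟨g, hg, hs, ho, hn⟩ := exists_isWeilTest_odd_sphere ha
      exact ⟨(weilQuadratic g).re, g, hg, hs, ho, hn, rfl⟩
    · rintro x ⟨g, hg, -, -, -, rfl⟩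
      exact hW g hg

/-- **The transfer is sound**: `RH ∧ NII′ → OddOneSignedWindows` (so, with the landed
`oddOneSignedWindows_imp_riemannHypothesis`, the crux is `RH ∧ NII′` up to RH-free glue, and
`NII′` is its provable, non-summit conjunct). -/
theorem oddOneSignedWindows_of_rh (hRH : _root_.RiemannHypothesis) (h : NonIntruderImpliesGood) :
    OddOneSignedWindows := by
  rw [oddOneSignedWindows_iff]
  intro A
  obtain ⟨a, hAa, himp⟩ := h A
  obtain ⟨u, hu, hsign⟩ := himp (weilOddGroundEnergy_nonneg_of_rh hRH a)
  exact ⟨a, hAa, u, hu, hsign⟩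

/-- Conversely the crux trivially gives NII′. -/
theorem nii_of_oddOneSignedWindows (h : OddOneSignedWindows) : NonIntruderImpliesGood := by
  rw [oddOneSignedWindows_iff] at h
  intro A
  obtain ⟨a, hAa, u, hu, hsign⟩ := h A
  exact ⟨a, hAa, fun _ => ⟨u, hu, hsign⟩⟩

/-- Hence `OddOneSignedWindows ↔ RH ∧ NII′`. -/
theorem oddOneSignedWindows_iff_rh_and_nii :
    OddOneSignedWindows ↔ (_root_.RiemannHypothesis ∧ NonIntruderImpliesGood) :=
  ⟨fun h => ⟨oddOneSignedWindows_imp_riemannHypothesis h, nii_of_oddOneSignedWindows h⟩,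
    fun h => oddOneSignedWindows_of_rh h.1 h.2⟩

/-! ## 4. The conditional dominance statement the line must prove (typed, open) -/

/-- **Conditional relative cluster dominance (the open stub of NII′'s line, stated i.o.).** Beyond
every height there is a window `a` such that IF `0 ≤ ε_od(a)` THEN some real odd ground state `u`
is relatively dominated by a de-leaked odd theta vector `c` away from the origin layer:
`|Re u − κ c| ≤ θ κ c` on `(η, a)` with `θ < 1`, and satisfies the origin-layer domination of the
landed `OriginLayerLemma` on `(0, η)` (abbreviated here to its conclusion on the layer). With
`CDConfinementL2` this gives `GoodWindow a`, i.e. NII′. It does NOT imply RH (its hypothesis fails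
eventually under ¬RH). -/
def ConditionalClusterDominance : Prop :=
  ∀ A : ℝ, ∃ a : ℝ, A ≤ a ∧ (0 ≤ weilOddGroundEnergy a →
    ∃ u : ℝ → ℂ, IsWeilOddGroundState a u ∧ (∀ t, (u t).im = 0) ∧
      ∃ (J : ℕ) (v : Fin J → ℝ) (κ θ η : ℝ), IsDeleakedL2 a v ∧ 0 < κ ∧ θ < 1 ∧ 0 < η ∧ η < a ∧
        (∀ t ∈ Ioo 0 a, 0 ≤ thetaOddCluster v t) ∧
        (∀ᵐ t : ℝ, t ∈ Ico η a → |(u t).re - κ * thetaOddCluster v t| ≤ θ * (κ * thetaOddCluster v t)) ∧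
        (∀ᵐ t : ℝ, t ∈ Ioo 0 η → 0 ≤ (u t).re))

/-- `ConditionalClusterDominance → NII′` (elementary: relative dominance by a non-negative profile
with `θ < 1` forces `Re u ≥ 0` on `[η, a)`; the layer clause covers `(0, η)`). -/
theorem nii_of_conditionalClusterDominance (h : ConditionalClusterDominance) :
    NonIntruderImpliesGood := by
  intro A
  obtain ⟨a, hAa, himp⟩ := h A
  refine ⟨a, hAa, fun hε => ?_⟩
  obtain ⟨u, hu, hreal, J, v, κ, θ, η, -, hκ, hθ, hη, hηa, hc, hdom, hlayer⟩ := himp hε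
  refine ⟨u, hu, ?_⟩
  filter_upwards [hdom, hlayer] with t ht hl htmem
  refine ⟨hreal t, ?_⟩
  by_cases hlt : t < η
  · exact hl ⟨htmem.1, hlt⟩
  · have hIco : t ∈ Ico η a := ⟨not_lt.1 hlt, htmem.2⟩
    have hct : 0 ≤ thetaOddCluster v t := hc t htmem
    have key := ht hIco
    have hκc : 0 ≤ κ * thetaOddCluster v t := mul_nonneg hκ.le hct
    have h1 : κ * thetaOddCluster v t - (u t).re ≤ θ * (κ * thetaOddCluster v t) :=
      le_trans (le_abs_self _) (by rwa [abs_sub_comm] at key)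
    nlinarith [h1, hκc, hθ]

end Summit.RiemannHypothesis.RiemannHypothesis.Cruxes.OddOneSignedWindows.DeleakedTheta

end
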